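import Summits.ResolutionOfSingularities.ResolutionOfSingularities.Theorems.EquisingularLiftEquisingularLiftNatEmbeddedLiftOfInfinitesimal
import Summits.ResolutionOfSingularities.ResolutionOfSingularities.Theorems.EquisingularLiftEquisingularLiftNatEmbeddedInfinitesimalLift
import Summits.ResolutionOfSingularities.ResolutionOfSingularities.Theorems.EquisingularLiftEquisingularLiftNatLiftOfIdealSheafData
import HarnessLib

/-!
# [OURS · L1 W4.5(b) · EL♮(3) · WIDTH TABLE D8, support debt S-D8-LIFT, brick (N-C4♭) = R70 (ii) TWIN-2, nose-w1's half] THE (F)-ASSEMBLY RESTARTED AT A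
# GIVEN FIRST-ORDER LIFT, MODULO ONLY GROTHENDIECK EXISTENCE **AT `(O, 𝔪_O, w)`** — so that F-88♭ (`grothendieckExistence_principal`, res-type-027) plugs in

res-L1-w45b-nose-w1 g5 (WIDTH seat D-0157 DOOR 1; S-D8-LIFT second pen under res-L1-w45b-stub-4 g14's plan `L/res-L1-w45b-stub-4/g13/S-D8-LIFT-PLAN.md`,
split of record bus 2026-08-29T04:20:51Z).  OURS; NOT a statement of any manuscript ([Hironaka2017] is a candidate under adjudication, nothing of it is
asserted); AI-written, weaker than expert review.  No `sorry`; standard axioms; DEF-FREE.  `--supports stmt-ResolutionOfSingularities-20148 --as helper`,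
counted 0.  EL♮(3) is NOT proved; resolution of singularities in positive characteristic is NOT proved.

R70 (ii) (desk 2026-08-29T05:37Z): the 45th candidate «F-88 RETIREMENT» re-threads the S-D8-LIFT chain with F-88♭ = E♭ `grothendieckExistence_principal`
(Grothendieck existence for a PRINCIPAL ideal of definition, a THEOREM res-type-027 derives from the tree's coherent-tower GE) in place of the hypothesis
`hGE : GrothendieckExistence.{0}`.  ✓ p696589 `exists_flat_lift_of_firstOrder` (…NatEmbeddedLiftOfFirstOrder) applies `hGE` at exactly ONE instance,
`(A, I, f) = (O, 𝔪_O, w)`; this module re-proves it with THAT INSTANCE as the only hypothesis (`hGEw`, the body of `GrothendieckExistence` at `(O, 𝔪_O, w)`),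
and derives the PRINCIPAL form (the old `hGE` form is ✓ p696589 itself, = this with `hGEw := hGE 𝔪_O w`): from any `hGEp` of E♭'s shape (F-88's body with `(I : Ideal A) [IsAdicComplete I A]` ↦
`(a : A) [IsAdicComplete (Ideal.span {a}) A]`, `I ↦ Ideal.span {a}`), since `𝔪_O = (ϖ)` for a uniformizer `ϖ` (transport by `subst` in
`grothendieckExistenceAt_of_principal`).  When E♭ lands, `exists_flat_lift_of_firstOrder_of_principal grothendieckExistence_principal …` is hypothesis-free.

WHAT (original N-C4 text).  `exists_flat_lift_of_firstOrder hGE` — F-88's (F) = ✓ `EmbeddedLiftFact` (…NatEmbeddedLiftFactDefs: `O` complete DVR, `θ : O ↠ k`, `w : W → Spec O`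
proper flat with model square `(jW, tW)`, `ι : Y₀ ↪ W₀` closed lci with `Ȟ¹(𝒩) = 0`; binders VERBATIM) with, IN ADDITION, a GIVEN first-order lift: a
closed `j₁ : Y₁ ↪ W₁ = W ×_O O/𝔪²`, flat over `O/𝔪²`, with `Y₀ = Y₁ ×_W W₀` (`hres₁`, J1's restriction clause at `n = 1`).  CONCLUSION: an ideal sheaf
`C` on `W`, `V(C) → Spec O` flat, with `C·𝒪_{W₁} = 𝓘_{Y₁}` (`C.comap (ι 1) = j₁.ker`) AND `C·𝒪_{W₀} = 𝓘_{Y₀}` (`C.comap jW = ι.ker`).  So the nodal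
discharge (stub-4's (C3)/(C5)/(C6)) may CHOOSE the first-order lift (the `c·ψ`-twist) and still algebraise it.
PROOF = res-type-027's ✓ `embeddedLiftFact_of_infinitesimal_of_grothendieckExistence` (…NatEmbeddedLiftOfInfinitesimal, Hartshorne 2010 Thm. 22.3's
proof) with the stage recursion STARTED AT `Stage 1 := ⟨Y₁, j₁, s₀, …⟩`: the infinitesimal step is the tree THEOREM ✓ `embeddedInfinitesimalLiftFact_holds`
(J1 PROVED, …NatEmbeddedInfinitesimalLift) applied for `n ≥ 1`; the tower `T 0 = Y₀`, `T (n+1) = stage n` is handed to `GrothendieckExistence` (F-88, the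
only hypothesis); flatness of `V(C) ≅ T'` by ✓ `flat_of_forall_flat_levels` (J3); the level-`1` square `hr 1` gives `C.comap (ι 1) = j₁.ker`
(✓ `ker_comap_eq_of_isPullback`) and the level-`0` square gives the special fibre as in 027's proof.  The one new bookkeeping item is the transition
square `Y₀ = Y₁ ×_{W₁} W_0` over `transition 0`, derived from `hres₁` by cancelling the closed immersion `ι 1 : W₁ ↪ W` and moving the isomorphism
`e 0 : W₀ ≅ W_0` (an isomorphism because `O/𝔪 → k` is bijective).
References (method / index only): R. Hartshorne, *Deformation Theory* (2010), Thm. 22.3 (proof); EGA III₁ 5.1.4 / Görtz–Wedhorn II Prop. 24.109.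
-/

set_option linter.dupNamespace false -- mandated namespace `Summit.<Summit>.<Problem>` of this single-conjunct summit

noncomputable section

open CategoryTheory CategoryTheory.Limits AlgebraicGeometry TopologicalSpace
open Literature.AlgebraicGeometry.Morphisms
open Literature.AlgebraicGeometry.Morphisms.infinitesimalNeighbourhood (toSpec transition transition_ι base)
open Literature.AlgebraicGeometry.Morphisms (CechMH1)
open Literature.AlgebraicGeometry.HodgeTheory (normalSheaf)
open Literature.AlgebraicGeometry.FormalGeometry (GrothendieckExistence)
open AlgebraicGeometry.Scheme.IdealSheafData

namespace Summit.ResolutionOfSingularities.ResolutionOfSingularities.Cruxes.EquisingularLiftNat.Sections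

/-- ★★ **(N-C4♭) THE (F)-ASSEMBLY RESTARTED AT A GIVEN FIRST-ORDER LIFT, MODULO GROTHENDIECK EXISTENCE AT `(O, 𝔪_O, w)` ONLY** (`hGEw` = the body of
`GrothendieckExistence` at that one instance).  Otherwise = ✓ `exists_flat_lift_of_firstOrder` verbatim (binders and conclusion).  See the module docstring.
[OURS · L1 W4.5b · (T-k)-N plumbing; counted 0] -/
theorem exists_flat_lift_of_firstOrder_of_grothendieckExistenceAt
    (O : Type) [CommRing O] [IsDomain O] [IsDiscreteValuationRing O] [IsAdicComplete (IsLocalRing.maximalIdeal O) O]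
    (k : Type) [Field k] (θ : O →+* k) (hθ : Function.Surjective θ)
    (W : Scheme.{0}) (w : W ⟶ Spec (.of O))
    (hGEw : ∀ [IsProper w] (T : ℕ → Scheme.{0}) (j : ∀ n, T n ⟶ infinitesimalNeighbourhood (IsLocalRing.maximalIdeal O) w n) (s : ∀ n, T n ⟶ T (n + 1)),
      (∀ n, IsClosedImmersion (j n)) → (∀ n, IsPullback (s n) (j n) (j (n + 1)) (transition (IsLocalRing.maximalIdeal O) w n)) →
        ∃ (T' : Scheme.{0}) (i : T' ⟶ W), IsClosedImmersion i ∧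
          ∃ r : ∀ n, T n ⟶ T', ∀ n, IsPullback (r n) (j n) i (infinitesimalNeighbourhood.ι (IsLocalRing.maximalIdeal O) w n))
    (W₀ : Scheme.{0}) (jW : W₀ ⟶ W) (tW : W₀ ⟶ Spec (.of k))
    (hsq : IsPullback jW tW w (Spec.map (CommRingCat.ofHom θ))) (hprop : IsProper w) (hflat : Flat w)
    (Y₀ : Scheme.{0}) (ι : Y₀ ⟶ W₀) (hι : IsClosedImmersion ι)
    (hlci : ∀ z : Y₀, ∃ U : W₀.affineOpens, ι.base z ∈ (U : W₀.Opens) ∧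
      ∃ rs : List Γ(W₀, U), RingTheory.Sequence.IsWeaklyRegular Γ(W₀, U) rs ∧ Ideal.ofList rs = ι.ker.ideal U)
    (hH1 : ∃ V : Fin 2 → Y₀.Opens, (∀ j, IsAffineOpen (V j)) ∧ IsAffineOpen (V 0 ⊓ V 1) ∧ ⨆ j, V j = ⊤ ∧
      Subsingleton (CechMH1 Y₀.toSpecΓ (normalSheaf ι) V))
    (Y₁ : Scheme.{0}) (j₁ : Y₁ ⟶ infinitesimalNeighbourhood (IsLocalRing.maximalIdeal O) w 1) [IsClosedImmersion j₁]
    (hfl₁ : Flat (j₁ ≫ infinitesimalNeighbourhood.toSpec (IsLocalRing.maximalIdeal O) w 1))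
    (hres₁ : ∃ s₀ : Y₀ ⟶ Y₁, IsPullback s₀ ι (j₁ ≫ infinitesimalNeighbourhood.ι (IsLocalRing.maximalIdeal O) w 1) jW) :
    ∃ C : W.IdealSheafData, Flat (C.subschemeι ≫ w) ∧
      C.comap (infinitesimalNeighbourhood.ι (IsLocalRing.maximalIdeal O) w 1) = j₁.ker ∧ C.comap jW = ι.ker := by
  haveI := hprop; haveI := hflat; haveI := hι
  -- `θ` kills the maximal ideal (θ : O ↠ k onto a field, `O` local)
  have hIθ : (IsLocalRing.maximalIdeal O) ≤ RingHom.ker θ :=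
    (IsLocalRing.eq_maximalIdeal (RingHom.ker_isMaximal_of_surjective θ hθ)).ge
  haveI : Fact (Function.Surjective θ) := ⟨hθ⟩
  -- the special fibre inside the infinitesimal neighbourhoods: `e n : W₀ ⟶ W_n`, closed immersions with `e n ≫ ι n = jW`
  let e : ∀ n : ℕ, W₀ ⟶ infinitesimalNeighbourhood (IsLocalRing.maximalIdeal O) w n := fun n =>
    hsq.isoPullback.hom ≫ toInfinitesimalNeighbourhood (IsLocalRing.maximalIdeal O) w θ hIθ n
  have he_ι : ∀ n, e n ≫ infinitesimalNeighbourhood.ι (IsLocalRing.maximalIdeal O) w n = jW := by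
    intro n; simp only [e, Category.assoc, toInfinitesimalNeighbourhood_ι, IsPullback.isoPullback_hom_fst]
  have he_tr : ∀ n, e n ≫ transition (IsLocalRing.maximalIdeal O) w n = e (n + 1) := by
    intro n; simp only [e, Category.assoc, toInfinitesimalNeighbourhood_transition]
  haveI : ∀ n, IsClosedImmersion (e n) := fun n => by
    simp only [e]; infer_instance
  -- `e 0` is an isomorphism (`O/𝔪 → k` is bijective)
  have hbij : Function.Bijective (fibreRingHom (IsLocalRing.maximalIdeal O) θ hIθ 0) := by
    refine ⟨RingHom.lift_injective_of_ker_le_ideal _ (fun a ha => hIθ (Ideal.pow_le_self (Nat.succ_ne_zero 0) ha)) ?_,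
      fun b => ?_⟩
    · rw [pow_one]; exact (IsLocalRing.eq_maximalIdeal (RingHom.ker_isMaximal_of_surjective θ hθ)).le
    · obtain ⟨a, rfl⟩ := hθ b
      exact ⟨Ideal.Quotient.mk _ a, rfl⟩
  haveI hiso0 : IsIso (CommRingCat.ofHom (fibreRingHom (IsLocalRing.maximalIdeal O) θ hIθ 0)) :=
    (RingEquiv.ofBijective _ hbij).toCommRingCatIso.isIso_hom
  haveI : IsIso (e 0) := by
    haveI : IsIso (toInfinitesimalNeighbourhood (IsLocalRing.maximalIdeal O) w θ hIθ 0) :=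
      (isPullback_toInfinitesimalNeighbourhood (IsLocalRing.maximalIdeal O) w θ hIθ 0).isIso_fst_of_isIso
    simp only [e]; infer_instance
  -- the stages of the recursion
  let Stage : ℕ → Type 1 := fun n =>
    Σ' (Y : Scheme.{0}) (j : Y ⟶ infinitesimalNeighbourhood (IsLocalRing.maximalIdeal O) w n) (s₀ : Y₀ ⟶ Y),
      IsClosedImmersion j ∧ Flat (j ≫ toSpec (IsLocalRing.maximalIdeal O) w n) ∧ IsPullback s₀ ι j (e n)
  -- level 1: the GIVEN first-order lift; its square over `e 1` from `hres₁` (cancel the closed immersion `ι 1`)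
  obtain ⟨s₀, hs₀⟩ := hres₁
  have hsq₁ : IsPullback s₀ ι j₁ (e 1) := by
    have hbig : IsPullback (s₀ ≫ 𝟙 Y₁) ι (j₁ ≫ infinitesimalNeighbourhood.ι (IsLocalRing.maximalIdeal O) w 1)
        (e 1 ≫ infinitesimalNeighbourhood.ι (IsLocalRing.maximalIdeal O) w 1) := by
      rw [Category.comp_id, he_ι]; exact hs₀
    refine IsPullback.of_right hbig ?_ (isPullback_id_of_mono j₁ (infinitesimalNeighbourhood.ι (IsLocalRing.maximalIdeal O) w 1))
    rw [← cancel_mono (infinitesimalNeighbourhood.ι (IsLocalRing.maximalIdeal O) w 1), Category.assoc, Category.assoc, he_ι]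
    exact hs₀.w
  let S1 : Stage 1 := ⟨Y₁, j₁, s₀, inferInstance, hfl₁, hsq₁⟩
  -- the step (J1, proved in the tree)
  have step : ∀ n (S : Stage n), ∃ (S' : Stage (n + 1)) (s : S.1 ⟶ S'.1),
      IsPullback s S.2.1 S'.2.1 (transition (IsLocalRing.maximalIdeal O) w n) := by
    intro n S
    obtain ⟨Y, j, s₀', hj, hjflat, hsqY⟩ := S
    haveI := hj
    have hres : ∃ s₀'' : Y₀ ⟶ Y, IsPullback s₀'' ι (j ≫ infinitesimalNeighbourhood.ι (IsLocalRing.maximalIdeal O) w n) jW := by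
      refine ⟨s₀', ?_⟩
      have h2 : IsPullback (𝟙 Y) j (j ≫ infinitesimalNeighbourhood.ι (IsLocalRing.maximalIdeal O) w n)
          (infinitesimalNeighbourhood.ι (IsLocalRing.maximalIdeal O) w n) :=
        isPullback_id_of_mono j (infinitesimalNeighbourhood.ι (IsLocalRing.maximalIdeal O) w n)
      simpa [he_ι] using hsqY.paste_horiz h2
    obtain ⟨Y', j', s, hj', hj'flat, hsq'⟩ := embeddedInfinitesimalLiftFact_holds O k θ hθ W w W₀ jW tW hsq hflat inferInstance Y₀ ι hι hlci
      hH1 n Y j hj hjflat hres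
    refine ⟨⟨Y', j', s₀' ≫ s, hj', hj'flat, ?_⟩, s, hsq'⟩
    simpa [he_tr] using hsqY.paste_horiz hsq'
  choose nextStage nextMap hnext using step
  -- the stages from level 1 on: `stage m : Stage (m + 1)`
  let stage : ∀ m : ℕ, Stage (m + 1) := fun m => Nat.rec S1 (fun m S => nextStage (m + 1) S) m
  have stage_zero : stage 0 = S1 := rfl
  have stage_succ : ∀ m, stage (m + 1) = nextStage (m + 1) (stage m) := fun m => rfl
  -- the tower handed to Grothendieck existence: `T 0 = Y₀`, `T (m+1) = stage m`
  let T : ℕ → Scheme.{0} := fun n => match n with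
    | 0 => Y₀
    | m + 1 => (stage m).1
  let j : ∀ n, T n ⟶ infinitesimalNeighbourhood (IsLocalRing.maximalIdeal O) w n :=
    fun n => match n with
    | 0 => ι ≫ e 0
    | m + 1 => (stage m).2.1
  have hjc : ∀ n, IsClosedImmersion (j n) := fun n => match n with
    | 0 => by change IsClosedImmersion (ι ≫ e 0); infer_instance
    | m + 1 => (stage m).2.2.2.1
  have hjflat : ∀ n, Flat (j n ≫ toSpec (IsLocalRing.maximalIdeal O) w n) := fun n => match n with
    | 0 => by
      have heq : (ι ≫ e 0) ≫ toSpec (IsLocalRing.maximalIdeal O) w 0 =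
          (ι ≫ tW) ≫ Spec.map (CommRingCat.ofHom (fibreRingHom (IsLocalRing.maximalIdeal O) θ hIθ 0)) := by
        simp only [e, Category.assoc, toInfinitesimalNeighbourhood_toSpec, IsPullback.isoPullback_hom_snd_assoc]
      change Flat ((ι ≫ e 0) ≫ toSpec (IsLocalRing.maximalIdeal O) w 0)
      rw [heq]; infer_instance
    | m + 1 => (stage m).2.2.2.2.1
  let s : ∀ n, T n ⟶ T (n + 1) := fun n => match n with
    | 0 => s₀
    | m + 1 => nextMap (m + 1) (stage m)
  have hs : ∀ n, IsPullback (s n) (j n) (j (n + 1)) (transition (IsLocalRing.maximalIdeal O) w n) := fun n => match n with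
    | 0 => by
      -- `Y₀ = Y₁ ×_{W₁} W_0` over `transition 0`: from `hsq₁` (over `e 1 = e 0 ≫ transition 0`) and the isomorphism `e 0`
      change IsPullback s₀ (ι ≫ e 0) j₁ (transition (IsLocalRing.maximalIdeal O) w 0)
      have h1 : IsPullback s₀ ι j₁ (e 0 ≫ transition (IsLocalRing.maximalIdeal O) w 0) := by rw [he_tr]; exact hsq₁
      have h2 : IsPullback (e 0 ≫ transition (IsLocalRing.maximalIdeal O) w 0) (e 0)
          (𝟙 (infinitesimalNeighbourhood (IsLocalRing.maximalIdeal O) w 1)) (transition (IsLocalRing.maximalIdeal O) w 0) :=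
        IsPullback.of_vert_isIso ⟨by rw [Category.comp_id]⟩
      simpa using h1.paste_vert h2
    | m + 1 => hnext (m + 1) (stage m)
  obtain ⟨T', i, hi, r, hr⟩ := hGEw T j s hjc hs
  haveI := hi
  refine ⟨i.ker, ?_, ?_, ?_⟩
  · -- flatness of `V(i.ker) ≅ T'` over `O`: every level `T_n → Spec O/𝔪ⁿ⁺¹` is flat (J3, scheme form)
    haveI : IsLocallyNoetherian W := LocallyOfFiniteType.isLocallyNoetherian w
    haveI : IsLocallyNoetherian T' := LocallyOfFiniteType.isLocallyNoetherian i
    have hlev : ∀ n, Flat (pullback.snd (i ≫ w) (base (IsLocalRing.maximalIdeal O) n)) := by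
      intro n
      have hTn : IsPullback (r n) (j n ≫ toSpec (IsLocalRing.maximalIdeal O) w n) (i ≫ w) (base (IsLocalRing.maximalIdeal O) n) :=
        (hr n).paste_vert (IsPullback.of_hasPullback w (base (IsLocalRing.maximalIdeal O) n))
      have hfn : Flat (j n ≫ toSpec (IsLocalRing.maximalIdeal O) w n) := hjflat n
      rw [← hTn.isoPullback_inv_snd]
      exact (MorphismProperty.cancel_left_of_respectsIso @Flat _ _).mpr hfn
    haveI hflat' : Flat (i ≫ w) := flat_of_forall_flat_levels (i ≫ w) hlev
    have h1 : Flat (i.toImage ≫ i.ker.subschemeι ≫ w) := by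
      rw [← Category.assoc]
      change Flat ((i.toImage ≫ i.imageι) ≫ w)
      rw [i.toImage_imageι]; exact hflat'
    exact (MorphismProperty.cancel_left_of_respectsIso @Flat i.toImage _).mp h1
  · -- level 1: `C·𝒪_{W₁} = 𝓘_{Y₁}`
    exact ker_comap_eq_of_isPullback (hr 1)
  · -- special fibre: level 0
    have hr0 : IsPullback (r 0) (ι ≫ e 0) i (infinitesimalNeighbourhood.ι (IsLocalRing.maximalIdeal O) w 0) := hr 0
    have h0sq : IsPullback (𝟙 Y₀) ι (ι ≫ e 0) (e 0) := isPullback_id_of_mono ι (e 0)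
    have h2 : IsPullback (𝟙 Y₀ ≫ r 0) ι i (e 0 ≫ infinitesimalNeighbourhood.ι (IsLocalRing.maximalIdeal O) w 0) := h0sq.paste_horiz hr0
    rw [Category.id_comp, he_ι] at h2
    rw [← ker_fst_of_isClosedImmersion i jW, ← h2.flip.isoPullback_inv_fst, Scheme.Hom.ker_comp_of_isIso]

/-- **Grothendieck existence AT an ideal that EQUALS a principal one**, from the PRINCIPAL form (E♭'s shape: F-88's body with `I := Ideal.span {a}`):
transport by `subst`. [OURS · pure logic] -/
theorem grothendieckExistenceAt_of_principal
    (hGEp : ∀ ⦃A : Type⦄ [CommRing A] [IsNoetherianRing A] (a : A) [IsAdicComplete (Ideal.span {a}) A] ⦃X : Scheme.{0}⦄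
      (f : X ⟶ Spec (.of A)) [IsProper f] (T : ℕ → Scheme.{0}) (j : ∀ n, T n ⟶ infinitesimalNeighbourhood (Ideal.span {a}) f n)
      (s : ∀ n, T n ⟶ T (n + 1)), (∀ n, IsClosedImmersion (j n)) → (∀ n, IsPullback (s n) (j n) (j (n + 1)) (transition (Ideal.span {a}) f n)) →
        ∃ (T' : Scheme.{0}) (i : T' ⟶ X), IsClosedImmersion i ∧ ∃ r : ∀ n, T n ⟶ T', ∀ n, IsPullback (r n) (j n) i (infinitesimalNeighbourhood.ι (Ideal.span {a}) f n))
    {A : Type} [CommRing A] [IsNoetherianRing A] (I : Ideal A) [IsAdicComplete I A] (a : A) (hI : I = Ideal.span {a})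
    {X : Scheme.{0}} (f : X ⟶ Spec (.of A)) [IsProper f] (T : ℕ → Scheme.{0}) (j : ∀ n, T n ⟶ infinitesimalNeighbourhood I f n)
    (s : ∀ n, T n ⟶ T (n + 1)) (hjc : ∀ n, IsClosedImmersion (j n)) (hs : ∀ n, IsPullback (s n) (j n) (j (n + 1)) (transition I f n)) :
    ∃ (T' : Scheme.{0}) (i : T' ⟶ X), IsClosedImmersion i ∧ ∃ r : ∀ n, T n ⟶ T', ∀ n, IsPullback (r n) (j n) i (infinitesimalNeighbourhood.ι I f n) := by
  subst hI
  exact hGEp a f T j s hjc hs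

/-- ★★ **(N-C4♭, PRINCIPAL FORM) THE (F)-ASSEMBLY RESTARTED AT A GIVEN FIRST-ORDER LIFT, MODULO GROTHENDIECK EXISTENCE FOR PRINCIPAL IDEALS OF
DEFINITION** (E♭'s shape, `hGEp`) — `𝔪_O = (ϖ)` for a uniformizer.  With F-88♭ `grothendieckExistence_principal` (res-type-027) for `hGEp` this is
hypothesis-free. [OURS · L1 W4.5b · R70 (ii) TWIN-2; counted 0] -/
theorem exists_flat_lift_of_firstOrder_of_principal
    (hGEp : ∀ ⦃A : Type⦄ [CommRing A] [IsNoetherianRing A] (a : A) [IsAdicComplete (Ideal.span {a}) A] ⦃X : Scheme.{0}⦄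
      (f : X ⟶ Spec (.of A)) [IsProper f] (T : ℕ → Scheme.{0}) (j : ∀ n, T n ⟶ infinitesimalNeighbourhood (Ideal.span {a}) f n)
      (s : ∀ n, T n ⟶ T (n + 1)), (∀ n, IsClosedImmersion (j n)) → (∀ n, IsPullback (s n) (j n) (j (n + 1)) (transition (Ideal.span {a}) f n)) →
        ∃ (T' : Scheme.{0}) (i : T' ⟶ X), IsClosedImmersion i ∧ ∃ r : ∀ n, T n ⟶ T', ∀ n, IsPullback (r n) (j n) i (infinitesimalNeighbourhood.ι (Ideal.span {a}) f n))
    (O : Type) [CommRing O] [IsDomain O] [IsDiscreteValuationRing O] [IsAdicComplete (IsLocalRing.maximalIdeal O) O]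
    (k : Type) [Field k] (θ : O →+* k) (hθ : Function.Surjective θ)
    (W : Scheme.{0}) (w : W ⟶ Spec (.of O)) (W₀ : Scheme.{0}) (jW : W₀ ⟶ W) (tW : W₀ ⟶ Spec (.of k))
    (hsq : IsPullback jW tW w (Spec.map (CommRingCat.ofHom θ))) (hprop : IsProper w) (hflat : Flat w)
    (Y₀ : Scheme.{0}) (ι : Y₀ ⟶ W₀) (hι : IsClosedImmersion ι)
    (hlci : ∀ z : Y₀, ∃ U : W₀.affineOpens, ι.base z ∈ (U : W₀.Opens) ∧
      ∃ rs : List Γ(W₀, U), RingTheory.Sequence.IsWeaklyRegular Γ(W₀, U) rs ∧ Ideal.ofList rs = ι.ker.ideal U)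
    (hH1 : ∃ V : Fin 2 → Y₀.Opens, (∀ j, IsAffineOpen (V j)) ∧ IsAffineOpen (V 0 ⊓ V 1) ∧ ⨆ j, V j = ⊤ ∧
      Subsingleton (CechMH1 Y₀.toSpecΓ (normalSheaf ι) V))
    (Y₁ : Scheme.{0}) (j₁ : Y₁ ⟶ infinitesimalNeighbourhood (IsLocalRing.maximalIdeal O) w 1) [IsClosedImmersion j₁]
    (hfl₁ : Flat (j₁ ≫ infinitesimalNeighbourhood.toSpec (IsLocalRing.maximalIdeal O) w 1))
    (hres₁ : ∃ s₀ : Y₀ ⟶ Y₁, IsPullback s₀ ι (j₁ ≫ infinitesimalNeighbourhood.ι (IsLocalRing.maximalIdeal O) w 1) jW) :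
    ∃ C : W.IdealSheafData, Flat (C.subschemeι ≫ w) ∧
      C.comap (infinitesimalNeighbourhood.ι (IsLocalRing.maximalIdeal O) w 1) = j₁.ker ∧ C.comap jW = ι.ker := by
  obtain ⟨ϖ, hϖ⟩ := IsDiscreteValuationRing.exists_irreducible O
  exact exists_flat_lift_of_firstOrder_of_grothendieckExistenceAt O k θ hθ W w
    (fun T j s hjc hs => grothendieckExistenceAt_of_principal hGEp (IsLocalRing.maximalIdeal O) ϖ hϖ.maximalIdeal_eq w T j s hjc hs)
    W₀ jW tW hsq hprop hflat Y₀ ι hι hlci hH1 Y₁ j₁ hfl₁ hres₁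

end Summit.ResolutionOfSingularities.ResolutionOfSingularities.Cruxes.EquisingularLiftNat.Sections

end
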